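import Summits.HubbardSuperconductivity.HubbardSuperconductivity.Theorems.KLProgrammeC4aTadpoleJetAssembly
import Summits.HubbardSuperconductivity.HubbardSuperconductivity.Theorems.KLProgrammeKLRegimeEngineV8DefsU12b

/-!
# Route `KLProgramme`, crux K3 — ENGINE (stmt-HubbardSuperconductivity-20437), row (C) `stub_twoLeg_curvature`, the SCALE-0 PRIVATE PAIR of `hres′` FROM THE RECORD ROWS,
# part 2/3: THE ARITHMETIC OF THE TABLES (pure real inequalities)

Seat hubbard-kl-k3c5-p1 (g20).  Part 1 (`…ScaleZeroRecordPairRaw`) leaves the assembly's tables at `tv = S·Ub²`, `tb k = 2ᵏ·S·Ub`, `a j = α = 10⁹⁸U⁸`, `bS₀ = bSA = c0 = 256·klScaleZeroA0`,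
`ε = β/4M` (`S = 2¹³e²⁷46³10¹⁹⁰`, `Ub = klTailBookU = 10⁻³⁰⁰`).  Here, with NO model object in sight:
* `scaleZero_tailConst_le` (`2ᵏ·S·Ub ≤ 10⁻⁸⁰`, k ≤ 4), `scaleZero_tailConstOn_le` (`S·Ub² ≤ 1/2`), `scaleZero_aliasConst_le` (`10⁹⁸U⁸ ≤ 10⁻⁸⁰` for `U ≤ Ub`);
* **`scaleZeroRawTables_le`** — for abstract `S, Ub, α, c0, ε` with those sizes and `0 ≤ D i`: the assembly's tables are below the PRIVATE tables
  `cP = (5, bS₁D₁ + δ, bS₂D₁² + bS₁D₂ + δ, sS₃ + δ, sS₄ + δ, 0, …)`, `cP′ = (2⁵², 0, …)`, `x₀ ≤ 2⁵³`, `δ := (1 + D₁ + D₂ + D₃ + D₄)⁴/10⁷⁸`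
  (every tail / aliasing Bell monomial is `≤ 10⁻⁸⁰·(1 + ΣD)⁴`; at most 45 per row).
Proofs only; no definitions; nothing here asserts (C), any stub of 20437, K3 or superconductivity.
References: BGM 2006 §2.4 (2.36)–(2.42) [cite: BenfattoGiulianiMastropietro2006].
-/

noncomputable section

namespace Summit.HubbardSuperconductivity.HubbardSuperconductivity.Theorems.KLRegimeSplit

set_option linter.dupNamespace false -- summit = problem name (single-conjunct summit), D-0017
set_option exponentiation.threshold 4096 -- `klTailBookU = 10⁻³⁰⁰` bookkeeping

open Real Finset
open Summit.HubbardSuperconductivity.HubbardSuperconductivity.Theorems.EngineV8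
open Summit.HubbardSuperconductivity.HubbardSuperconductivity.Theorems.C4a (bell4)

/-! ## §1 The small coefficients -/

section Small

variable {U : ℝ}

/-- The booked tail constants are tiny: `2ᵏ·2¹³e²⁷46³·10¹⁹⁰·klTailBookU ≤ 10⁻⁸⁰` for `k ≤ 4`. -/
theorem scaleZero_tailConst_le (k : ℕ) (hk : k ≤ 4) :
    (2 : ℝ) ^ k * ((2 : ℝ) ^ 13 * Real.exp 1 ^ 27 * (46 : ℝ) ^ 3 * ((10 : ℝ) ^ 95) ^ 2) * klTailBookU ≤ 1 / (10 : ℝ) ^ 80 := by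
  have he3 : Real.exp 1 ≤ 3 := by have := Real.exp_one_lt_d9; norm_num at this; linarith
  have he0 : 0 ≤ Real.exp 1 := (Real.exp_pos 1).le
  have h27 : Real.exp 1 ^ 27 ≤ (3 : ℝ) ^ 27 := pow_le_pow_left₀ he0 he3 27
  have h2k : (2 : ℝ) ^ k ≤ 2 ^ 4 := pow_le_pow_right₀ (by norm_num) hk
  have h95 : (0 : ℝ) < ((10 : ℝ) ^ 95) ^ 2 := pow_pos (pow_pos (by norm_num) 95) 2
  have hsplit : ((10 : ℝ) ^ 95) ^ 2 * (1 / (10 : ℝ) ^ 300) = 1 / (10 : ℝ) ^ 110 := by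
    rw [show (10 : ℝ) ^ 300 = ((10 : ℝ) ^ 95) ^ 2 * (10 : ℝ) ^ 110 by rw [← pow_mul, ← pow_add], mul_one_div, div_mul_eq_div_div,
      div_self h95.ne']
  have hsplit2 : (1 : ℝ) / (10 : ℝ) ^ 110 = 1 / (10 : ℝ) ^ 30 * (1 / (10 : ℝ) ^ 80) := by
    rw [show (10 : ℝ) ^ 110 = (10 : ℝ) ^ 30 * (10 : ℝ) ^ 80 by rw [← pow_add], one_div_mul_one_div]
  have hnum : (2 : ℝ) ^ 4 * ((2 : ℝ) ^ 13 * (3 : ℝ) ^ 27 * (46 : ℝ) ^ 3) ≤ (10 : ℝ) ^ 30 := by norm_num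
  unfold klTailBookU
  calc (2 : ℝ) ^ k * ((2 : ℝ) ^ 13 * Real.exp 1 ^ 27 * (46 : ℝ) ^ 3 * ((10 : ℝ) ^ 95) ^ 2) * (1 / 10 ^ 300)
      ≤ (2 : ℝ) ^ 4 * ((2 : ℝ) ^ 13 * (3 : ℝ) ^ 27 * (46 : ℝ) ^ 3 * ((10 : ℝ) ^ 95) ^ 2) * (1 / 10 ^ 300) := by gcongr
    _ = (2 : ℝ) ^ 4 * ((2 : ℝ) ^ 13 * (3 : ℝ) ^ 27 * (46 : ℝ) ^ 3) * (((10 : ℝ) ^ 95) ^ 2 * (1 / (10 : ℝ) ^ 300)) := by ring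
    _ = (2 : ℝ) ^ 4 * ((2 : ℝ) ^ 13 * (3 : ℝ) ^ 27 * (46 : ℝ) ^ 3) * (1 / (10 : ℝ) ^ 30) * (1 / (10 : ℝ) ^ 80) := by rw [hsplit, hsplit2]; ring
    _ ≤ (10 : ℝ) ^ 30 * (1 / (10 : ℝ) ^ 30) * (1 / (10 : ℝ) ^ 80) := by gcongr
    _ = 1 / (10 : ℝ) ^ 80 := by rw [mul_one_div_cancel (pow_ne_zero 30 (by norm_num)), one_mul]

/-- The booked on-site tail constant is tiny: `2¹³e²⁷46³·10¹⁹⁰·klTailBookU² ≤ 1/2`. -/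
theorem scaleZero_tailConstOn_le :
    ((2 : ℝ) ^ 13 * Real.exp 1 ^ 27 * (46 : ℝ) ^ 3 * ((10 : ℝ) ^ 95) ^ 2) * klTailBookU ^ 2 ≤ 1 / 2 := by
  have h := scaleZero_tailConst_le 0 (by norm_num)
  rw [pow_zero, one_mul] at h
  have hU : klTailBookU ≤ 1 := by
    unfold klTailBookU; rw [div_le_one (by positivity)]; exact one_le_pow₀ (by norm_num)
  have hU0 : 0 ≤ klTailBookU := klTailBookU_pos.le
  have hS0 : 0 ≤ ((2 : ℝ) ^ 13 * Real.exp 1 ^ 27 * (46 : ℝ) ^ 3 * ((10 : ℝ) ^ 95) ^ 2) * klTailBookU :=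
    mul_nonneg (mul_nonneg (mul_nonneg (mul_nonneg (pow_nonneg zero_le_two 13) (pow_nonneg (Real.exp_pos 1).le 27)) (pow_nonneg (by norm_num) 3))
      (pow_nonneg (pow_nonneg (by norm_num) 95) 2)) klTailBookU_pos.le
  calc ((2 : ℝ) ^ 13 * Real.exp 1 ^ 27 * (46 : ℝ) ^ 3 * ((10 : ℝ) ^ 95) ^ 2) * klTailBookU ^ 2
      = (((2 : ℝ) ^ 13 * Real.exp 1 ^ 27 * (46 : ℝ) ^ 3 * ((10 : ℝ) ^ 95) ^ 2) * klTailBookU) * klTailBookU := by ring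
    _ ≤ (1 / (10 : ℝ) ^ 80) * 1 := mul_le_mul h hU hU0 (by positivity)
    _ ≤ 1 / 2 := by norm_num

/-- The aliasing table is tiny: `10⁹⁸·U⁸ ≤ 10⁻⁸⁰` for `0 < U ≤ klTailBookU`. -/
theorem scaleZero_aliasConst_le (hU : 0 < U) (hUb : U ≤ klTailBookU) : (10 : ℝ) ^ 98 * U ^ 8 ≤ 1 / (10 : ℝ) ^ 80 := by
  have hU1 : U ≤ 1 / (10 : ℝ) ^ 300 := by unfold klTailBookU at hUb; exact hUb
  have h8 : U ^ 8 ≤ (1 / (10 : ℝ) ^ 300) ^ 8 := pow_le_pow_left₀ hU.le hU1 8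
  have hpow : (1 / (10 : ℝ) ^ 300) ^ 8 = 1 / (10 : ℝ) ^ 2400 := by rw [div_pow, one_pow, ← pow_mul]
  have hsplit : (10 : ℝ) ^ 98 * (1 / (10 : ℝ) ^ 2400) = 1 / (10 : ℝ) ^ 2302 := by
    rw [show (10 : ℝ) ^ 2400 = (10 : ℝ) ^ 98 * (10 : ℝ) ^ 2302 by rw [← pow_add], mul_one_div, div_mul_eq_div_div,
      div_self (pow_ne_zero 98 (by norm_num))]
  calc (10 : ℝ) ^ 98 * U ^ 8 ≤ (10 : ℝ) ^ 98 * (1 / (10 : ℝ) ^ 300) ^ 8 := by gcongr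
    _ = 1 / (10 : ℝ) ^ 2302 := by rw [hpow, hsplit]
    _ ≤ 1 / (10 : ℝ) ^ 80 := one_div_le_one_div_of_le (by positivity) (pow_le_pow_right₀ (by norm_num) (by norm_num))


end Small

/-! ## §2 The arithmetic of the private tables (pure real inequalities) -/

section Tables

set_option linter.unusedSimpArgs false in -- the `if`-reductions below are discharged by hypotheses OR by literal simprocs, depending on the case
/-- **RAW TABLES ≤ PRIVATE TABLES**: with `tb k = 2ᵏ·S·Ub ≤ 10⁻⁸⁰` (k ≤ 4), `tv = S·Ub² ≤ 1/2`, `a j = α ≤ 10⁻⁸⁰`, `bS₀ = bSA = c0 ≤ 2⁵¹`, `ε ≤ 1`, `0 ≤ D i`: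
the assembly's tables are below `cP = (5, bS₁D₁ + δ, bS₂D₁² + bS₁D₂ + δ, sS₃ + δ, sS₄ + δ, 0, …)`, `cP′ = (2⁵², 0, …)`, `x₀ ≤ 2⁵³`, `δ = (1 + D₁ + D₂ + D₃ + D₄)⁴/10⁷⁸`
(every tail / aliasing Bell monomial is `≤ 10⁻⁸⁰·(1 + ΣD)⁴`, at most 45 of them per row). -/
theorem scaleZeroRawTables_le {S Ub α c0 ε : ℝ} {bS sS D : ℕ → ℝ} (hS0 : 0 ≤ S) (hUb0 : 0 ≤ Ub)
    (htb : ∀ k ≤ 4, (2 : ℝ) ^ k * S * Ub ≤ 1 / (10 : ℝ) ^ 80) (htv : S * Ub ^ 2 ≤ 1 / 2) (hα : α ≤ 1 / (10 : ℝ) ^ 80)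
    (hc0 : c0 ≤ (2 : ℝ) ^ 51) (hε : ε ≤ 1) (hD : ∀ i, 1 ≤ i → i ≤ 4 → 0 ≤ D i) :
    (∀ k, (fun k => if k = 0 then 2 * (S * Ub ^ 2) + 4
          else if k = 1 then 2 * ((2 : ℝ) ^ 1 * S * Ub) * D 1 + ((fun k : ℕ => if k = 0 then c0 else bS k) 1 * D 1 + bell4 (fun _ : ℕ => α) D 1)
          else if k = 2 then 2 * ((2 : ℝ) ^ 2 * S * Ub) * D 1 ^ 2 + 2 * ((2 : ℝ) ^ 1 * S * Ub) * D 2 +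
            ((fun k : ℕ => if k = 0 then c0 else bS k) 2 * D 1 ^ 2 + (fun k : ℕ => if k = 0 then c0 else bS k) 1 * D 2 + bell4 (fun _ : ℕ => α) D 2)
          else if k = 3 then 2 * ((2 : ℝ) ^ 3 * S * Ub) * D 1 ^ 3 + 3 * (2 * ((2 : ℝ) ^ 2 * S * Ub)) * D 1 * D 2 + 2 * ((2 : ℝ) ^ 1 * S * Ub) * D 3 +
            (sS 3 + bell4 (fun _ : ℕ => α) D 3)
          else if k = 4 then 2 * ((2 : ℝ) ^ 4 * S * Ub) * D 1 ^ 4 + 6 * (2 * ((2 : ℝ) ^ 3 * S * Ub)) * D 1 ^ 2 * D 2 + 3 * (2 * ((2 : ℝ) ^ 2 * S * Ub)) * D 2 ^ 2 +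
            4 * (2 * ((2 : ℝ) ^ 2 * S * Ub)) * D 1 * D 3 + 2 * ((2 : ℝ) ^ 1 * S * Ub) * D 4 + (sS 4 + bell4 (fun _ : ℕ => α) D 4)
          else 0) k ≤
      (fun k => if k = 0 then 5 else if k = 1 then bS 1 * D 1 + (1 + D 1 + D 2 + D 3 + D 4) ^ 4 / (10 : ℝ) ^ 78
          else if k = 2 then bS 2 * D 1 ^ 2 + bS 1 * D 2 + (1 + D 1 + D 2 + D 3 + D 4) ^ 4 / (10 : ℝ) ^ 78
          else if k = 3 then sS 3 + (1 + D 1 + D 2 + D 3 + D 4) ^ 4 / (10 : ℝ) ^ 78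
          else if k = 4 then sS 4 + (1 + D 1 + D 2 + D 3 + D 4) ^ 4 / (10 : ℝ) ^ 78 else 0) k) ∧
    (∀ k, (fun k => if k = 0 then 2 * ((2 : ℝ) ^ 0 * S * Ub) + (c0 + (fun _ : ℕ => α) 0 + 2048 + 64 * ε) else 0) k ≤ (fun k => if k = 0 then (2 : ℝ) ^ 52 else 0) k) ∧
    (4 * ((2 : ℝ) ^ 0 * S * Ub) + 2 * ((fun k : ℕ => if k = 0 then c0 else bS k) 0 + (fun _ : ℕ => α) 0)) ≤ (2 : ℝ) ^ 53 := by
  have hD1 : 0 ≤ D 1 := hD 1 le_rfl (by norm_num)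
  have hD2 : 0 ≤ D 2 := hD 2 (by norm_num) (by norm_num)
  have hD3 : 0 ≤ D 3 := hD 3 (by norm_num) (by norm_num)
  have hD4 : 0 ≤ D 4 := hD 4 (by norm_num) le_rfl
  set T : ℝ := 1 + D 1 + D 2 + D 3 + D 4 with hT
  have hT1 : 1 ≤ T := by rw [hT]; linarith
  have hT0 : 0 ≤ T := zero_le_one.trans hT1
  have hTD1 : D 1 ≤ T := by rw [hT]; linarith
  have hTD2 : D 2 ≤ T := by rw [hT]; linarith
  have hTD3 : D 3 ≤ T := by rw [hT]; linarith
  have hTD4 : D 4 ≤ T := by rw [hT]; linarith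
  have hT4 : T ≤ T ^ 4 := le_self_pow₀ hT1 (by norm_num)
  have hT24 : T ^ 2 ≤ T ^ 4 := pow_le_pow_right₀ hT1 (by norm_num)
  have hT34 : T ^ 3 ≤ T ^ 4 := pow_le_pow_right₀ hT1 (by norm_num)
  have hT40 : 0 ≤ T ^ 4 := by positivity
  -- monomials ≤ T⁴
  have m1 : D 1 ≤ T ^ 4 := hTD1.trans hT4
  have m2 : D 2 ≤ T ^ 4 := hTD2.trans hT4
  have m3 : D 3 ≤ T ^ 4 := hTD3.trans hT4
  have m4 : D 4 ≤ T ^ 4 := hTD4.trans hT4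
  have m11 : D 1 ^ 2 ≤ T ^ 4 := (pow_le_pow_left₀ hD1 hTD1 2).trans hT24
  have m111 : D 1 ^ 3 ≤ T ^ 4 := (pow_le_pow_left₀ hD1 hTD1 3).trans hT34
  have m1111 : D 1 ^ 4 ≤ T ^ 4 := pow_le_pow_left₀ hD1 hTD1 4
  have hTT : T * T ≤ T ^ 4 := (sq T).symm.trans_le hT24
  have m12 : D 1 * D 2 ≤ T ^ 4 := (mul_le_mul hTD1 hTD2 hD2 hT0).trans hTT
  have m22 : D 2 ^ 2 ≤ T ^ 4 := (pow_le_pow_left₀ hD2 hTD2 2).trans hT24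
  have m13 : D 1 * D 3 ≤ T ^ 4 := (mul_le_mul hTD1 hTD3 hD3 hT0).trans hTT
  have m112 : D 1 ^ 2 * D 2 ≤ T ^ 4 :=
    (mul_le_mul (pow_le_pow_left₀ hD1 hTD1 2) hTD2 hD2 (pow_nonneg hT0 2)).trans ((pow_succ T 2).symm.trans_le hT34)
  -- the small coefficients
  have e0 := htb 0 (by norm_num)
  have e1 := htb 1 (by norm_num)
  have e2 := htb 2 (by norm_num)
  have e3 := htb 3 (by norm_num)
  have e4 := htb 4 (by norm_num)
  have e0' : S * Ub ≤ 1 / (10 : ℝ) ^ 80 := by have h := e0; rwa [pow_zero, one_mul] at h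
  have t0 : ∀ k, 0 ≤ (2 : ℝ) ^ k * S * Ub := fun k => mul_nonneg (mul_nonneg (pow_nonneg zero_le_two k) hS0) hUb0
  have n10 : (1 : ℕ) ≠ 0 := by decide
  have n20 : (2 : ℕ) ≠ 0 := by decide
  have n21 : (2 : ℕ) ≠ 1 := by decide
  have n30 : (3 : ℕ) ≠ 0 := by decide
  have n31 : (3 : ℕ) ≠ 1 := by decide
  have n32 : (3 : ℕ) ≠ 2 := by decide
  have n40 : (4 : ℕ) ≠ 0 := by decide
  have n41 : (4 : ℕ) ≠ 1 := by decide
  have n42 : (4 : ℕ) ≠ 2 := by decide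
  have n43 : (4 : ℕ) ≠ 3 := by decide
  refine ⟨fun k => ?_, fun k => ?_, ?_⟩
  · rcases Nat.lt_or_ge k 5 with hk5 | hk5
    · interval_cases k
      · -- k = 0
        simp only [if_true]
        linarith only [htv]
      · -- k = 1
        simp only [bell4, n10, if_false, if_true]
        have h1 : 2 * ((2 : ℝ) ^ 1 * S * Ub) * D 1 ≤ 2 * (1 / (10 : ℝ) ^ 80) * T ^ 4 :=
          mul_le_mul (by linarith only [e1]) m1 hD1 (by positivity)
        have h2 : α * D 1 ≤ (1 / (10 : ℝ) ^ 80) * T ^ 4 := mul_le_mul hα m1 hD1 (by positivity)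
        linarith only [h1, h2, hT40]
      · -- k = 2
        simp only [bell4, n10, n20, n21, if_false, if_true]
        have h1 : 2 * ((2 : ℝ) ^ 2 * S * Ub) * D 1 ^ 2 ≤ 2 * (1 / (10 : ℝ) ^ 80) * T ^ 4 :=
          mul_le_mul (by linarith only [e2]) m11 (by positivity) (by positivity)
        have h2 : 2 * ((2 : ℝ) ^ 1 * S * Ub) * D 2 ≤ 2 * (1 / (10 : ℝ) ^ 80) * T ^ 4 :=
          mul_le_mul (by linarith only [e1]) m2 hD2 (by positivity)
        have h3 : α * D 1 ^ 2 ≤ (1 / (10 : ℝ) ^ 80) * T ^ 4 := mul_le_mul hα m11 (by positivity) (by positivity)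
        have h4 : α * D 2 ≤ (1 / (10 : ℝ) ^ 80) * T ^ 4 := mul_le_mul hα m2 hD2 (by positivity)
        linarith only [h1, h2, h3, h4, hT40]
      · -- k = 3
        simp only [bell4, n10, n30, n31, n32, if_false, if_true]
        have h1 : 2 * ((2 : ℝ) ^ 3 * S * Ub) * D 1 ^ 3 ≤ 2 * (1 / (10 : ℝ) ^ 80) * T ^ 4 :=
          mul_le_mul (by linarith only [e3]) m111 (by positivity) (by positivity)
        have h2 : 3 * (2 * ((2 : ℝ) ^ 2 * S * Ub)) * D 1 * D 2 ≤ 6 * (1 / (10 : ℝ) ^ 80) * T ^ 4 := by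
          have : 3 * (2 * ((2 : ℝ) ^ 2 * S * Ub)) * (D 1 * D 2) ≤ 6 * (1 / (10 : ℝ) ^ 80) * T ^ 4 :=
            mul_le_mul (by linarith only [e2]) m12 (by positivity) (by positivity)
          linarith only [this, show 3 * (2 * ((2 : ℝ) ^ 2 * S * Ub)) * D 1 * D 2 = 3 * (2 * ((2 : ℝ) ^ 2 * S * Ub)) * (D 1 * D 2) by ring]
        have h3 : 2 * ((2 : ℝ) ^ 1 * S * Ub) * D 3 ≤ 2 * (1 / (10 : ℝ) ^ 80) * T ^ 4 :=
          mul_le_mul (by linarith only [e1]) m3 hD3 (by positivity)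
        have h4 : α * D 1 ^ 3 ≤ (1 / (10 : ℝ) ^ 80) * T ^ 4 := mul_le_mul hα m111 (by positivity) (by positivity)
        have h5 : 3 * α * D 1 * D 2 ≤ 3 * (1 / (10 : ℝ) ^ 80) * T ^ 4 := by
          have : 3 * α * (D 1 * D 2) ≤ 3 * (1 / (10 : ℝ) ^ 80) * T ^ 4 := mul_le_mul (by linarith only [hα]) m12 (by positivity) (by positivity)
          linarith only [this, show 3 * α * D 1 * D 2 = 3 * α * (D 1 * D 2) by ring]
        have h6 : α * D 3 ≤ (1 / (10 : ℝ) ^ 80) * T ^ 4 := mul_le_mul hα m3 hD3 (by positivity)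
        linarith only [h1, h2, h3, h4, h5, h6, hT40]
      · -- k = 4
        simp only [bell4, n10, n40, n41, n42, n43, if_false, if_true]
        have h1 : 2 * ((2 : ℝ) ^ 4 * S * Ub) * D 1 ^ 4 ≤ 2 * (1 / (10 : ℝ) ^ 80) * T ^ 4 :=
          mul_le_mul (by linarith only [e4]) m1111 (by positivity) (by positivity)
        have h2 : 6 * (2 * ((2 : ℝ) ^ 3 * S * Ub)) * D 1 ^ 2 * D 2 ≤ 12 * (1 / (10 : ℝ) ^ 80) * T ^ 4 := by
          have : 6 * (2 * ((2 : ℝ) ^ 3 * S * Ub)) * (D 1 ^ 2 * D 2) ≤ 12 * (1 / (10 : ℝ) ^ 80) * T ^ 4 :=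
            mul_le_mul (by linarith only [e3]) m112 (by positivity) (by positivity)
          linarith only [this, show 6 * (2 * ((2 : ℝ) ^ 3 * S * Ub)) * D 1 ^ 2 * D 2 = 6 * (2 * ((2 : ℝ) ^ 3 * S * Ub)) * (D 1 ^ 2 * D 2) by ring]
        have h3 : 3 * (2 * ((2 : ℝ) ^ 2 * S * Ub)) * D 2 ^ 2 ≤ 6 * (1 / (10 : ℝ) ^ 80) * T ^ 4 :=
          mul_le_mul (by linarith only [e2]) m22 (by positivity) (by positivity)
        have h4 : 4 * (2 * ((2 : ℝ) ^ 2 * S * Ub)) * D 1 * D 3 ≤ 8 * (1 / (10 : ℝ) ^ 80) * T ^ 4 := by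
          have : 4 * (2 * ((2 : ℝ) ^ 2 * S * Ub)) * (D 1 * D 3) ≤ 8 * (1 / (10 : ℝ) ^ 80) * T ^ 4 :=
            mul_le_mul (by linarith only [e2]) m13 (by positivity) (by positivity)
          linarith only [this, show 4 * (2 * ((2 : ℝ) ^ 2 * S * Ub)) * D 1 * D 3 = 4 * (2 * ((2 : ℝ) ^ 2 * S * Ub)) * (D 1 * D 3) by ring]
        have h5 : 2 * ((2 : ℝ) ^ 1 * S * Ub) * D 4 ≤ 2 * (1 / (10 : ℝ) ^ 80) * T ^ 4 :=
          mul_le_mul (by linarith only [e1]) m4 hD4 (by positivity)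
        have h6 : α * D 1 ^ 4 ≤ (1 / (10 : ℝ) ^ 80) * T ^ 4 := mul_le_mul hα m1111 (by positivity) (by positivity)
        have h7 : 6 * α * D 1 ^ 2 * D 2 ≤ 6 * (1 / (10 : ℝ) ^ 80) * T ^ 4 := by
          have : 6 * α * (D 1 ^ 2 * D 2) ≤ 6 * (1 / (10 : ℝ) ^ 80) * T ^ 4 := mul_le_mul (by linarith only [hα]) m112 (by positivity) (by positivity)
          linarith only [this, show 6 * α * D 1 ^ 2 * D 2 = 6 * α * (D 1 ^ 2 * D 2) by ring]
        have h8 : 3 * α * D 2 ^ 2 ≤ 3 * (1 / (10 : ℝ) ^ 80) * T ^ 4 := mul_le_mul (by linarith only [hα]) m22 (by positivity) (by positivity)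
        have h9 : 4 * α * D 1 * D 3 ≤ 4 * (1 / (10 : ℝ) ^ 80) * T ^ 4 := by
          have : 4 * α * (D 1 * D 3) ≤ 4 * (1 / (10 : ℝ) ^ 80) * T ^ 4 := mul_le_mul (by linarith only [hα]) m13 (by positivity) (by positivity)
          linarith only [this, show 4 * α * D 1 * D 3 = 4 * α * (D 1 * D 3) by ring]
        have h10 : α * D 4 ≤ (1 / (10 : ℝ) ^ 80) * T ^ 4 := mul_le_mul hα m4 hD4 (by positivity)
        linarith only [h1, h2, h3, h4, h5, h6, h7, h8, h9, h10, hT40]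
    · have h0 : k ≠ 0 := by omega
      have h1 : k ≠ 1 := by omega
      have h2 : k ≠ 2 := by omega
      have h3 : k ≠ 3 := by omega
      have h4 : k ≠ 4 := by omega
      simp only [h0, h1, h2, h3, h4, if_false, le_refl]
  · rcases Nat.eq_zero_or_pos k with rfl | hk
    · simp only [if_true, pow_zero, one_mul]
      linarith only [e0', hc0, hα, hε]
    · have h0 : k ≠ 0 := by omega
      simp only [h0, if_false, le_refl]
  · simp only [if_true, pow_zero, one_mul]
    linarith only [e0', hc0, hα]

end Tables

end Summit.HubbardSuperconductivity.HubbardSuperconductivity.Theorems.KLRegimeSplit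

end
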